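import Summits.PneNP.PneNP.Theses.RootDecompAdviceProvability

/-!
# `RootDecompAdviceProvability.UPlusImpliesU` (stmt-PneNP-28073) — the edge placing the road U⁺ under N1's rung U

Node N12 of the decomp-pnenp root-decomposition cell (route `route-PneNP-RootDecompAdviceProvability`,
lens-5 g4 «AdviceProvabilityCut») records as a support-designate aside the edge
`U⁺ ⟹ U`: if `S₂¹` does not prove «NP ⊆ P/poly» in advice form (provably-Δᵇ₁ relation + term-bounded
advice), then `S₂¹` does not prove «NP = coNP» (N1's provability rung `NoS12ProofOfNPeqCoNP`,
stmt-PneNP-26831, whose text the item inlines verbatim).  Proof (lens kernel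
`noS12ProofOfNPeqCoNP_of_uPlus` / `provNPinPpoly_of_provesNPeqCoNP`, HOME/decomp-pnenp-lens-5/
AdviceProvabilityCut.lean sha256 27f516ff…, ported here as private lemmas against the tree modules
`BoundedArithSyntax` / `BoundedArithTheories`): if every `Πᵇ₁` formula has an `S₂¹`-provably equivalent
`Σᵇ₁` mate, then a `Σᵇ₁` formula `φ(x, b)` is its own advice-taking relation with the EMPTY advice
`a := b` (bounding term `t(n) := n`), and its `Πᵇ₁` mate is the negation of the `Σᵇ₁` mate of `∼φ`.
Census tribunal batch 1 (TRIB-PNENP-ROOTDECOMP-1) lists the item as provable-now.  0 sorry.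
-/

namespace Summit.PneNP.PneNP.Theorems

open FirstOrder FirstOrder.Language FirstOrder.Language.BoundedFormula
open Literature.Computability.MetaComplexity

section AdviceSemantics

variable {M : Type*} [Language.boundedArith.Structure M]

/-- Semantics of the atomic formula `t₁ ≤ t₂` in a bare `boundedArith`-structure: the interpretation of
Buss's `≤` symbol on the pair of realized terms (the models of `S₂¹` quantified over by `⊨ᵇ` carry no
order instance).  Port of the lens lemma. -/
private theorem realize_le_iff {α : Type*} {n : ℕ} (t₁ t₂ : Language.boundedArith.Term (α ⊕ Fin n))
    (v : α → M) (xs : Fin n → M) :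
    (Term.le t₁ t₂).Realize v xs ↔
      Structure.RelMap (L := Language.boundedArith) BoundedArithRel.le
        ![t₁.realize (Sum.elim v xs), t₂.realize (Sum.elim v xs)] := by
  rw [Term.le, realize_rel₂]
  rfl

/-- Semantics of the advice sentence `b ≤ n → (∃ a ≤ t(n)) (∀ x ≤ n) (φ(x, b) ↔ χ(x, a))` as it is
inlined in the route items (free variables `0 = n`, `1 = b`; `φ`'s input `↦ x`, parameter `↦ b`;
`χ`'s input `↦ x`, advice `↦ a`), in an arbitrary structure `M`.  Port of the lens lemma
`realize_adviceFormula`. -/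
private theorem realize_advice (φ χ : Language.boundedArith.Formula (Fin 2))
    (t : Language.boundedArith.Term (Fin 1)) (v : Fin 2 → M) (xs : Fin 0 → M) :
    BoundedFormula.Realize
        (BoundedFormula.imp (Term.le (Term.var (Sum.inl 1)) (Term.var (Sum.inl 0)))
          (bexLE (t.relabel fun _ => (Sum.inl 0 : Fin 2 ⊕ Fin 0))
            (ballLE (Term.var (Sum.inl 0))
              (BoundedFormula.iff
                (BoundedFormula.relabel ![Sum.inr 1, Sum.inl 1] φ :
                  Language.boundedArith.BoundedFormula (Fin 2) 2)
                (BoundedFormula.relabel ![Sum.inr 1, Sum.inr 0] χ :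
                  Language.boundedArith.BoundedFormula (Fin 2) 2))))) v xs ↔
      (Structure.RelMap (L := Language.boundedArith) BoundedArithRel.le ![v 1, v 0] →
        ∃ a : M, Structure.RelMap (L := Language.boundedArith) BoundedArithRel.le ![a, t.realize ![v 0] ] ∧
          ∀ x : M, Structure.RelMap (L := Language.boundedArith) BoundedArithRel.le ![x, v 0] →
            (φ.Realize ![x, v 1] ↔ χ.Realize ![x, a])) := by
  have hxs : xs = default := Subsingleton.elim _ _
  subst hxs
  have e1 : ∀ a : M, (((Sum.elim v (Fin.snoc (default : Fin 0 → M) a) ∘ Sum.map id Fin.castSucc) ∘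
      fun _ : Fin 1 => (Sum.inl 0 : Fin 2 ⊕ Fin 0)) : Fin 1 → M) = ![v 0] := fun a => by
    funext i; fin_cases i; rfl
  have e2 : ∀ a x : M, (Sum.elim v (Fin.snoc (Fin.snoc (default : Fin 0 → M) a) x ∘ Fin.castAdd 0) ∘
      (![Sum.inr 1, Sum.inl 1] : Fin 2 → Fin 2 ⊕ Fin 2)) = ![x, v 1] := fun a x => by
    funext i; fin_cases i <;> rfl
  have e3 : ∀ a x : M, (Sum.elim v (Fin.snoc (Fin.snoc (default : Fin 0 → M) a) x ∘ Fin.castAdd 0) ∘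
      (![Sum.inr 1, Sum.inr 0] : Fin 2 → Fin 2 ⊕ Fin 2)) = ![x, a] := fun a x => by
    funext i; fin_cases i <;> rfl
  have e4 : ∀ a x : M, (Fin.snoc (Fin.snoc (default : Fin 0 → M) a) x ∘ Fin.natAdd 2 : Fin 0 → M) =
      default := fun _ _ => Subsingleton.elim _ _
  have e5 : ∀ a : M, (Fin.snoc (default : Fin 0 → M) a : Fin 1 → M) (Fin.last 0) = a := fun a => rfl
  have e6 : ∀ a x : M,
      (Fin.snoc (Fin.snoc (default : Fin 0 → M) a) x : Fin 2 → M) (Fin.last (0 + 1)) = x :=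
    fun a x => rfl
  simp only [bexLE, ballLE, realize_imp, realize_ex, realize_all, realize_inf,
    realize_iff, realize_le_iff, realize_relabel, Term.realize_relabel, Term.realize_var,
    Sum.elim_inl, Sum.elim_inr, Function.comp_apply, Sum.map_inl, id_eq, e1, e2, e3, e4, e5, e6,
    Formula.Realize]

end AdviceSemantics

/-- The edge `U⁺ ⟹ U` of node N12 (stmt-PneNP-28073): if `S₂¹` does not prove «NP ⊆ P/poly» in advice
form, then `S₂¹` does not prove «NP = coNP» (some `Πᵇ₁` formula has no provably equivalent `Σᵇ₁`
mate).  Contrapositive: from provable `NP = coNP`, every `Σᵇ₁` formula `φ(x, b)` gets the provably-Δᵇ₁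
pair `(φ, ∼χ)` with `χ` the `Σᵇ₁` mate of `∼φ`, and the advice sentence holds with the empty advice
`a := b`, `t(n) := n`.  Port of the lens-5 g4 kernel `noS12ProofOfNPeqCoNP_of_uPlus`
(decomp-pnenp cell, 2026-08-30). -/
theorem uPlusImpliesU_proof :
    Summit.PneNP.PneNP.Theses.RootDecompAdviceProvability.UPlusImpliesU := by
  unfold Summit.PneNP.PneNP.Theses.RootDecompAdviceProvability.UPlusImpliesU
  intro hU
  by_contra h
  apply hU
  intro φ hφ
  push Not at h
  obtain ⟨χ, hχ, hiff⟩ := h 2 (∼φ) (IsSigmab.not (i := 0) hφ)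
  refine ⟨φ, ∼χ, Term.var 0, hφ, IsSigmab.not (i := 0) hχ, ?_, ?_⟩
  · intro M v xs
    have h1 := hiff M v xs
    simp only [realize_iff, realize_not] at h1 ⊢
    tauto
  · intro M v xs
    rw [realize_advice]
    intro hb
    exact ⟨v 1, by simpa using hb, fun x _ => Iff.rfl⟩

end Summit.PneNP.PneNP.Theorems
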